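import Mathlib
import Summits.KontsevichZagierPeriods.KontsevichZagierPeriods.Theorems.TorsionLogsNeronTorsionSectorStubHaarReps
import Summits.KontsevichZagierPeriods.KontsevichZagierPeriods.Theorems.TorsionLogsNeronTorsionSectorStubDlogUnfold
import Summits.KontsevichZagierPeriods.KontsevichZagierPeriods.Theorems.TorsionLogsNeronTorsionSectorStubTranslationCalculus
import Literature.NumberTheory.Transcendental.KZLogCalculusProofs
import HarnessLib

/-!
# Stub `stub_logStep` — crux `TorsionLogs.NeronTorsionSector`, line `registered` (block W4):
# one regular LOG step on a lower cell

On the identity component of the real cubic `y² = f(x) = 4x³ − g₂x − g₃` take two consecutive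
lower cells `(a, b)`, `(b, c)` of the torsion grid (`0 < a < b < c` algebraic, `f > 0` on
`(a, ∞)`), the lower-branch translation `τ` by `P₁ = (x₁, y₁)` in regular chord form (it maps
`(b, c)` increasingly onto `(a, b)`), the third-kind potential `Qf`, and the two representations
`θ₁ = [(b, c), Qf/√f]`, `θ₂ = [(a, b), Qf/√f]`.  Given a dlog potential `G` on `[b, c]`
(`G′ = G · (Qf∘τ − Qf)/yb`, continuous, non-vanishing, `ℚ`-semialgebraic), we prove that
`[θ₂] − [θ₁]` is, modulo `KZ.relations`, a `ℤ`-combination of interval log carriers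
`[(αᵢ, βᵢ), dt/t]` whose values add up to `log |G b| − log |G c|`.

The chain of moves:
1. rule (2) along `τ` (`of_sub_of_mem_relations_of_cov_fin_one`): `θ₂ ≡ r_mid = [(b,c), (Qf∘τ)/√f]`,
   the Jacobian being the Haar identity `|τ′| = √f∘τ/√f` (`stub_translationCalculus`, parts (a),
   (b), with `ε = −1`); the absolute convergence of `r_mid` is transported from that of `θ₂` by
   `MeasureTheory.integrableOn_image_iff_integrableOn_abs_det_fderiv_smul`, and the
   semialgebraicity of `Qf ∘ τ` from that of the integrand of `θ₂`
   (`IsSemialgebraicFunOn.comp_isSemialgebraicMapOn_holds`);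
2. integrand additivity: `r_mid − θ₁ ≡ r_diff = [(b,c), (Qf∘τ − Qf)/√f]`;
3. on `(b, c)`, `(Qf∘τ − Qf)/√f = −G′/G`; `G` has constant sign `s` on `[b, c]` (intermediate
   value theorem), `|G| = sG`, and `stub_dlogUnfold` applied to `[(b,c), (sG)′/(sG)] = −r_diff`
   unfolds it into interval log carriers with values summing to `log (|G c|/|G b|)`;
4. the signs of the coefficients are flipped.

References: M. Kontsevich, D. Zagier, *Periods* (2001), §1.2 rules (1)–(3); J. H. Silverman,
*The Arithmetic of Elliptic Curves* (2nd ed., 2009), III.5 (invariant differential).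
-/

noncomputable section

-- `Summit.KontsevichZagierPeriods.KontsevichZagierPeriods.…` is the tree's mandated layout (single-conjunct summit).
set_option linter.dupNamespace false

open Set MeasureTheory Filter Topology MvPolynomial
open Literature.NumberTheory.Transcendental Literature.ModelTheory.ExponentialFields
open Summit.KontsevichZagierPeriods.HyperbolicBloch.OffTetraSectorKernel (isSemialgebraic_logIvl)
open Summit.KontsevichZagierPeriods.HermiteRigidity.GenusTwoCycleTransfer (hasFDerivAt_fin_one
  det_smul_id_fin_one)

namespace Summit.KontsevichZagierPeriods.KontsevichZagierPeriods.Cruxes.NeronTorsionSector.Translation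

/-- **A continuous non-vanishing function on `[b, c]` has constant sign** `s = ±1` there
(intermediate value theorem). [folklore] -/
theorem logStep_sign {b c : ℝ} {G : ℝ → ℝ} (hbc : b ≤ c) (hGc : ContinuousOn G (Icc b c))
    (hG0 : ∀ x ∈ Icc b c, G x ≠ 0) :
    ∃ s : ℝ, (s = 1 ∨ s = -1) ∧ ∀ x ∈ Icc b c, 0 < s * G x := by
  have hb : b ∈ Icc b c := left_mem_Icc.2 hbc
  rcases lt_or_gt_of_ne (hG0 b hb) with hneg | hpos
  · refine ⟨-1, Or.inr rfl, fun x hx => ?_⟩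
    have hx' : G x < 0 := by
      by_contra h
      rw [not_lt] at h
      obtain ⟨y, hy, hy0⟩ :=
        intermediate_value_Icc hx.1 (hGc.mono (Icc_subset_Icc le_rfl hx.2)) ⟨hneg.le, h⟩
      exact hG0 y ⟨hy.1, hy.2.trans hx.2⟩ hy0
    linarith
  · refine ⟨1, Or.inl rfl, fun x hx => ?_⟩
    have hx' : 0 < G x := by
      by_contra h
      rw [not_lt] at h
      obtain ⟨y, hy, hy0⟩ :=
        intermediate_value_Icc' hx.1 (hGc.mono (Icc_subset_Icc le_rfl hx.2)) ⟨h, hpos.le⟩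
      exact hG0 y ⟨hy.1, hy.2.trans hx.2⟩ hy0
    linarith

/-- **The chord numerator `M(x) = 4x² + 4xx₁ + 4x₁² − g₂` in one coordinate is
`ℚ`-semialgebraic** (algebraic constants are `ℚ`-definable; closure under `+`, `−`, `*`).
[cite: BochnakCosteRoy1998, Prop. 2.2.6] -/
theorem isSemialgebraicFunOn_chordM_apply {n : ℕ} {s : Set (Fin n → ℝ)}
    (hs : IsSemialgebraic ℚ s) {g₂ x₁ : ℝ} (h₂ : IsAlgebraic ℚ g₂) (hx₁ : IsAlgebraic ℚ x₁)
    (k : Fin n) :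
    IsSemialgebraicFunOn ℚ s (fun x => 4 * x k ^ 2 + 4 * x k * x₁ + 4 * x₁ ^ 2 - g₂) := by
  have hX : IsSemialgebraicFunOn ℚ s (fun x => x k) :=
    (isSemialgebraicFunOn_aeval hs (X k)).congr fun x _ => by simp
  have h4 : IsSemialgebraicFunOn ℚ s (fun _ => (4 : ℝ)) :=
    (isSemialgebraicFunOn_ratCast hs 4).congr fun x _ => by norm_num
  have hx₁c := isSemialgebraicFunOn_const_of_isAlgebraic hs hx₁
  have hg₂c := isSemialgebraicFunOn_const_of_isAlgebraic hs h₂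
  have h := IsSemialgebraicFunOn.sub_holds
    (IsSemialgebraicFunOn.add_holds
      (IsSemialgebraicFunOn.add_holds
        (IsSemialgebraicFunOn.mul_holds h4 (IsSemialgebraicFunOn.mul_holds hX hX))
        (IsSemialgebraicFunOn.mul_holds (IsSemialgebraicFunOn.mul_holds h4 hX) hx₁c))
      (IsSemialgebraicFunOn.mul_holds h4 (IsSemialgebraicFunOn.mul_holds hx₁c hx₁c)))
    hg₂c
  refine h.congr fun x _ => ?_
  simp only [Pi.add_apply, Pi.sub_apply, Pi.mul_apply]
  ring

/-- **STUB W4 (`stub_logStep`, size M–L) — one regular LOG step on a lower cell.** For consecutive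
lower cells `(a, b)` and `(b, c)` of the torsion grid (so `τ`, the lower-branch translation in regular chord
form, maps `(b, c)` increasingly onto `(a, b)`), the third-kind reps `θ₁ = [(b,c), Qf/√f]` and
`θ₂ = [(a,b), Qf/√f]` differ by interval logarithms: `θ₂ ≡ [(b,c), (Qf∘τ)/√f]` (rule (2) along `τ`, Haar
invariance `|τ′|/√f∘τ = 1/√f` from `stub_translationCalculus`), the difference `[(b,c), (Qf∘τ − Qf)/√f]`
has integrand `−G′/G` for the dlog potential `G` (hypotheses; supplied by `stub_dlogPotential`), and
`stub_dlogUnfold` applied to `|G|` on `[b, c]` unfolds it. [cite: KontsevichZagier2001, §1.2 rules (2),(3)] -/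
theorem stub_logStep :
    ∀ (g₂ g₃ x₁ y₁ a b c : ℝ) (f yb sl τ Y3 Qf G : ℝ → ℝ)
      (θ₁ θ₂ : Literature.NumberTheory.Transcendental.KZ.IntegralRep 1),
    (∀ x, f x = 4 * x ^ 3 - g₂ * x - g₃) → y₁ ^ 2 = f x₁ → y₁ < 0 →
    IsAlgebraic ℚ g₂ → IsAlgebraic ℚ g₃ → IsAlgebraic ℚ x₁ → IsAlgebraic ℚ y₁ →
    IsAlgebraic ℚ a → IsAlgebraic ℚ b → IsAlgebraic ℚ c → 0 < a → a < b → b < c →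
    (∀ x, a < x → 0 < f x) →
    yb = (fun x => -Real.sqrt (f x)) →
    sl = (fun x => (4 * x ^ 2 + 4 * x * x₁ + 4 * x₁ ^ 2 - g₂) / (yb x + y₁)) →
    τ = (fun x => sl x ^ 2 / 4 - x - x₁) →
    Y3 = (fun x => -(yb x + sl x * (τ x - x))) →
    Qf = (fun x => sl x / 2 + Y3 x / (2 * τ x) - yb x / (2 * x)) →
    StrictMonoOn τ (Set.Icc b c) → τ '' Set.Ioo b c = Set.Ioo a b → ContinuousOn τ (Set.Icc b c) →
    θ₁.domain = {t | b < t 0 ∧ t 0 < c} →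
    Set.EqOn θ₁.integrand (fun t => Qf (t 0) / Real.sqrt (f (t 0))) θ₁.domain →
    θ₂.domain = {t | a < t 0 ∧ t 0 < b} →
    Set.EqOn θ₂.integrand (fun t => Qf (t 0) / Real.sqrt (f (t 0))) θ₂.domain →
    ContinuousOn G (Set.Icc b c) → (∀ x ∈ Set.Icc b c, G x ≠ 0) →
    (∀ x ∈ Set.Ioo b c, HasDerivAt G (G x * ((Qf (τ x) - Qf x) / yb x)) x) →
    IsSemialgebraicFunOn ℚ {t : Fin 1 → ℝ | t 0 ∈ Set.Icc b c} (fun t => G (t 0)) →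
    ∃ (κ : ℕ) (α β : Fin κ → ℝ) (ε : Fin κ → ℤ)
      (cs : Fin κ → Literature.NumberTheory.Transcendental.KZ.IntegralRep 1),
      (∀ i, 0 < α i ∧ α i ≤ β i ∧ IsAlgebraic ℚ (α i) ∧ IsAlgebraic ℚ (β i) ∧
        (cs i).domain = {t | α i < t 0 ∧ t 0 < β i} ∧
        Set.EqOn (cs i).integrand (fun t => 1 / t 0) (cs i).domain) ∧
      ∑ i, (ε i : ℝ) * Real.log (β i / α i) = Real.log |G b| - Real.log |G c| ∧
      Literature.NumberTheory.Transcendental.KZ.of θ₂ - Literature.NumberTheory.Transcendental.KZ.of θ₁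
        - ∑ i, ε i • Literature.NumberTheory.Transcendental.KZ.of (cs i) ∈
        Literature.NumberTheory.Transcendental.KZ.relations := by
  intro g₂ g₃ x₁ y₁ a b c f yb sl τ Y3 Qf G θ₁ θ₂ hf hy₁ hy₁0 h₂ h₃ hx₁ hy₁a ha hb hc ha0 hab hbc hfpos
    hyb hsl hτ hY3 hQf hτmono hτimg _hτc hθ₁d hθ₁i hθ₂d hθ₂i hGc hG0 hGd hGσ
  /- ## Pointwise facts along the lower branch -/
  have hybx : ∀ x, yb x = -Real.sqrt (f x) := fun x => by rw [hyb]
  have hne : ∀ x, yb x + y₁ ≠ 0 := fun x => by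
    have h0 : yb x ≤ 0 := by rw [hybx]; exact neg_nonpos.2 (Real.sqrt_nonneg _)
    intro h
    linarith
  have hyb' : yb = fun x => (-1) * Real.sqrt (f x) := by
    rw [hyb]
    funext x
    rw [neg_one_mul]
  obtain ⟨hcurve, hderiv, -, -⟩ := stub_translationCalculus g₂ g₃ x₁ y₁ (-1) f yb sl τ Y3 Qf hf hy₁
    (Or.inr rfl) hyb' hsl hτ hY3 hQf
  have hfI : ∀ x ∈ Ioo b c, 0 < f x := fun x hx => hfpos x (hab.trans hx.1)
  have hτI : ∀ x ∈ Ioo b c, τ x ∈ Ioo a b := fun x hx => by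
    have h : τ x ∈ τ '' Ioo b c := mem_image_of_mem τ hx
    rwa [hτimg] at h
  have hfτI : ∀ x ∈ Ioo b c, 0 < f (τ x) := fun x hx => hfpos _ (hτI x hx).1
  have hτd : ∀ x ∈ Ioo b c, HasDerivAt τ (Y3 x / yb x) x := fun x hx => hderiv x (hfI x hx) (hne x)
  -- the Haar identity `|τ′| = √f∘τ / √f`
  have habsτ' : ∀ x ∈ Ioo b c, |Y3 x / yb x| = Real.sqrt (f (τ x)) / Real.sqrt (f x) :=
    fun x hx => by
      rw [abs_div, ← Real.sqrt_sq_eq_abs, hcurve x (hfI x hx) (hne x), hybx x, abs_neg,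
        abs_of_nonneg (Real.sqrt_nonneg _)]
  have hinjτ : InjOn τ (Ioo b c) := hτmono.injOn.mono Ioo_subset_Icc_self
  /- ## The slab `S = (b, c)` of `ℝ¹` and the semialgebraic functions on it -/
  set S : Set (Fin 1 → ℝ) := {t | b < t 0 ∧ t 0 < c} with hS
  have hSσ : IsSemialgebraic ℚ S := isSemialgebraic_logIvl hb hc
  have hS₂σ : IsSemialgebraic ℚ {t : Fin 1 → ℝ | a < t 0 ∧ t 0 < b} := isSemialgebraic_logIvl ha hb
  have hmeas : MeasurableSet S := IsSemialgebraic.measurableSet_holds hSσ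
  have hSθ₁ : ∀ t, t ∈ S → t ∈ θ₁.domain := fun t ht => by rw [hθ₁d]; exact ht
  have hsqrt_ne : ∀ t ∈ S, Real.sqrt (f (t 0)) ≠ 0 := fun t ht =>
    (Real.sqrt_pos.2 (hfI _ ht)).ne'
  have hsqrtτ_ne : ∀ t ∈ S, Real.sqrt (f (τ (t 0))) ≠ 0 := fun t ht =>
    (Real.sqrt_pos.2 (hfτI _ ht)).ne'
  have hyb_ne : ∀ t ∈ S, yb (t 0) ≠ 0 := fun t ht => by
    rw [hybx]
    exact neg_ne_zero.2 (hsqrt_ne t ht)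
  have hmaps₂ : MapsTo (fun (p : Fin 1 → ℝ) (_ : Fin 1) => τ (p 0)) S
      {t : Fin 1 → ℝ | a < t 0 ∧ t 0 < b} := fun p hp => hτI (p 0) hp
  have hmaps : MapsTo (fun (p : Fin 1 → ℝ) (_ : Fin 1) => τ (p 0)) S θ₂.domain := fun p hp => by
    rw [hθ₂d]
    exact hmaps₂ hp
  have hθ₁i' : ∀ t ∈ S, θ₁.integrand t = Qf (t 0) / Real.sqrt (f (t 0)) := fun t ht =>
    hθ₁i (hSθ₁ t ht)
  have hθ₂i' : ∀ p ∈ S, θ₂.integrand (fun _ => τ (p 0)) = Qf (τ (p 0)) / Real.sqrt (f (τ (p 0))) :=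
    fun p hp => hθ₂i (hmaps hp)
  -- coordinate, constants, `√f`, `yb`, `sl`, `τ`
  have hX : IsSemialgebraicFunOn ℚ S (fun t => t 0) :=
    (isSemialgebraicFunOn_aeval hSσ (X 0)).congr fun t _ => by simp
  have h4 : IsSemialgebraicFunOn ℚ S (fun _ => (4 : ℝ)) :=
    (isSemialgebraicFunOn_ratCast hSσ 4).congr fun x _ => by norm_num
  have hx₁c := isSemialgebraicFunOn_const_of_isAlgebraic hSσ hx₁
  have hy₁c := isSemialgebraicFunOn_const_of_isAlgebraic hSσ hy₁a
  have hsqrtS : IsSemialgebraicFunOn ℚ S (fun t => Real.sqrt (f (t 0))) :=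
    isSemialgebraicFunOn_sqrt_cubic_apply hSσ h₂ h₃ hf 0
  have hybS : IsSemialgebraicFunOn ℚ S (fun t => yb (t 0)) :=
    hsqrtS.neg.congr fun t _ => by rw [Pi.neg_apply, hybx]
  have hslS : IsSemialgebraicFunOn ℚ S (fun t => sl (t 0)) :=
    ((isSemialgebraicFunOn_chordM_apply hSσ h₂ hx₁ 0).div
      (IsSemialgebraicFunOn.add_holds hybS hy₁c) fun t _ => hne (t 0)).congr fun t _ => by
        simp only [hsl, Pi.add_apply]
  have hτS : IsSemialgebraicFunOn ℚ S (fun t => τ (t 0)) :=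
    (IsSemialgebraicFunOn.sub_holds (IsSemialgebraicFunOn.sub_holds
      ((IsSemialgebraicFunOn.mul_holds hslS hslS).div h4 fun _ _ => four_ne_zero) hX) hx₁c).congr
      fun t _ => by
        simp only [hτ, Pi.sub_apply, Pi.mul_apply]
        ring
  have hΦσ : IsSemialgebraicMapOn ℚ S (fun (p : Fin 1 → ℝ) (_ : Fin 1) => τ (p 0)) :=
    IsSemialgebraicMapOn.of_forall hSσ fun _ => hτS
  -- `√f ∘ τ`, `Qf ∘ τ` (from the integrand of `θ₂`), `Qf` (from the integrand of `θ₁`)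
  have hsqrtτS : IsSemialgebraicFunOn ℚ S (fun p => Real.sqrt (f (τ (p 0)))) :=
    IsSemialgebraicFunOn.comp_isSemialgebraicMapOn_holds
      (g := fun t : Fin 1 → ℝ => Real.sqrt (f (t 0)))
      (isSemialgebraicFunOn_sqrt_cubic_apply hS₂σ h₂ h₃ hf 0) hΦσ hmaps₂
  have hθ₂comp : IsSemialgebraicFunOn ℚ S (fun p => θ₂.integrand (fun _ => τ (p 0))) :=
    IsSemialgebraicFunOn.comp_isSemialgebraicMapOn_holds θ₂.isSemialgebraicFunOn_integrand hΦσ hmaps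
  have hQfτS : IsSemialgebraicFunOn ℚ S (fun p => Qf (τ (p 0))) :=
    (IsSemialgebraicFunOn.mul_holds hθ₂comp hsqrtτS).congr fun p hp => by
      simp only [Pi.mul_apply]
      rw [hθ₂i' p hp]
      exact div_mul_cancel₀ _ (hsqrtτ_ne p hp)
  have hθ₁σ : IsSemialgebraicFunOn ℚ S θ₁.integrand := by
    have h := θ₁.isSemialgebraicFunOn_integrand
    rwa [hθ₁d] at h
  have hQfS : IsSemialgebraicFunOn ℚ S (fun p => Qf (p 0)) :=
    (IsSemialgebraicFunOn.mul_holds hθ₁σ hsqrtS).congr fun p hp => by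
      simp only [Pi.mul_apply]
      rw [hθ₁i' p hp]
      exact div_mul_cancel₀ _ (hsqrt_ne p hp)
  /- ## Step 1: the pulled-back representation `r_mid = [(b,c), (Qf∘τ)/√f]` and rule (2) -/
  have hmidσ : IsSemialgebraicFunOn ℚ S (fun p => Qf (τ (p 0)) / Real.sqrt (f (p 0))) :=
    hQfτS.div hsqrtS hsqrt_ne
  have hinjΦ : InjOn (fun (p : Fin 1 → ℝ) (_ : Fin 1) => τ (p 0)) S := fun p hp q hq h => by
    have h0 : τ (p 0) = τ (q 0) := congr_fun h 0
    funext i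
    rw [Fin.fin_one_eq_zero i]
    exact hinjτ hp hq h0
  have himg : (fun (p : Fin 1 → ℝ) (_ : Fin 1) => τ (p 0)) '' S = θ₂.domain := by
    rw [hθ₂d]
    exact image_slab_eq hτimg
  have hmid_int : IntegrableOn (fun p : Fin 1 → ℝ => Qf (τ (p 0)) / Real.sqrt (f (p 0))) S := by
    have key : IntegrableOn θ₂.integrand ((fun (p : Fin 1 → ℝ) (_ : Fin 1) => τ (p 0)) '' S) := by
      rw [himg]
      exact θ₂.integrableOn
    have key' := (integrableOn_image_iff_integrableOn_abs_det_fderiv_smul volume hmeas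
      (f' := fun p : Fin 1 → ℝ => (Y3 (p 0) / yb (p 0)) • ContinuousLinearMap.id ℝ (Fin 1 → ℝ))
      (fun p hp => (hasFDerivAt_fin_one τ (Y3 (p 0) / yb (p 0)) p (hτd (p 0) hp)).hasFDerivWithinAt)
      hinjΦ θ₂.integrand).1 key
    refine key'.congr_fun (fun p hp => ?_) hmeas
    show |((Y3 (p 0) / yb (p 0)) • ContinuousLinearMap.id ℝ (Fin 1 → ℝ)).det| •
        θ₂.integrand (fun _ => τ (p 0)) = Qf (τ (p 0)) / Real.sqrt (f (p 0))
    rw [det_smul_id_fin_one, smul_eq_mul, habsτ' _ hp, hθ₂i' p hp, div_mul_div_comm,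
      mul_comm (Real.sqrt (f (τ (p 0)))) (Qf (τ (p 0))), mul_div_mul_right _ _ (hsqrtτ_ne p hp)]
  obtain ⟨rmid, hrmid_d, hrmid_i⟩ : ∃ r : KZ.IntegralRep 1, r.domain = S ∧
      r.integrand = fun p => Qf (τ (p 0)) / Real.sqrt (f (p 0)) :=
    ⟨⟨S, fun p => Qf (τ (p 0)) / Real.sqrt (f (p 0)), hSσ, hmidσ, hmid_int⟩, rfl, rfl⟩
  have hA : KZ.of rmid - KZ.of θ₂ ∈ KZ.relations := by
    refine of_sub_of_mem_relations_of_cov_fin_one (I := Ioo b c) rmid θ₂ hrmid_d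
      (by rw [hrmid_d]; exact hτS) hτd hinjτ (by rw [hθ₂d, hτimg]; rfl) fun p hp => ?_
    rw [hrmid_d] at hp
    rw [hrmid_i, hθ₂i' p hp, habsτ' _ hp, div_mul_div_comm,
      mul_comm (Real.sqrt (f (τ (p 0)))) (Real.sqrt (f (p 0))), mul_div_mul_right _ _ (hsqrtτ_ne p hp)]
  /- ## Step 2: integrand additivity, `r_mid − θ₁ ≡ r_diff = [(b,c), (Qf∘τ − Qf)/√f]` -/
  have hdiffσ : IsSemialgebraicFunOn ℚ S
      (fun p => (Qf (τ (p 0)) - Qf (p 0)) / Real.sqrt (f (p 0))) :=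
    (IsSemialgebraicFunOn.sub_holds hQfτS hQfS).div hsqrtS hsqrt_ne
  have hdiff_int : IntegrableOn
      (fun p : Fin 1 → ℝ => (Qf (τ (p 0)) - Qf (p 0)) / Real.sqrt (f (p 0))) S := by
    have h₁ : IntegrableOn θ₁.integrand S := by
      have h := θ₁.integrableOn
      rwa [hθ₁d] at h
    refine (hmid_int.sub h₁).congr_fun (fun p hp => ?_) hmeas
    rw [Pi.sub_apply, hθ₁i' p hp, sub_div]
  obtain ⟨rdiff, hrdiff_d, hrdiff_i⟩ : ∃ r : KZ.IntegralRep 1, r.domain = S ∧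
      r.integrand = fun p => (Qf (τ (p 0)) - Qf (p 0)) / Real.sqrt (f (p 0)) :=
    ⟨⟨S, _, hSσ, hdiffσ, hdiff_int⟩, rfl, rfl⟩
  have hB : KZ.of rmid - KZ.of θ₁ - KZ.of rdiff ∈ KZ.relations := by
    refine KZ.integrandAddRel_subset_relations ⟨1, rmid, θ₁, rdiff, by rw [hθ₁d, hrmid_d],
      by rw [hrdiff_d, hrmid_d], fun p hp => ?_, rfl⟩
    rw [hrmid_d] at hp
    rw [Pi.add_apply, hrmid_i, hrdiff_i, hθ₁i' p hp]
    ring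
  have hC : KZ.of rdiff + KZ.of rdiff.neg ∈ KZ.relations :=
    KZ.of_add_of_mem_relations_of_eqOn_neg rfl fun _ _ => rfl
  /- ## Step 3: `−r_diff = [(b,c), (sG)′/(sG)]` unfolds into interval logarithms -/
  obtain ⟨s, hs1, hspos⟩ := logStep_sign hbc.le hGc hG0
  have hsalg : IsAlgebraic ℚ s := by
    rcases hs1 with rfl | rfl
    · exact isAlgebraic_one
    · exact isAlgebraic_one.neg
  have hsabs : |s| = 1 := by rcases hs1 with rfl | rfl <;> simp
  have habs : ∀ x ∈ Icc b c, |G x| = s * G x := fun x hx => by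
    have h := abs_of_pos (hspos x hx)
    rwa [abs_mul, hsabs, one_mul] at h
  have hIccσ : IsSemialgebraic ℚ {t : Fin 1 → ℝ | t 0 ∈ Icc b c} :=
    IsSemialgebraicFunOn.isSemialgebraic_holds hGσ
  have hGpσ : IsSemialgebraicFunOn ℚ {t : Fin 1 → ℝ | t 0 ∈ Icc b c} (fun t => s * G (t 0)) :=
    IsSemialgebraicFunOn.mul_holds (isSemialgebraicFunOn_const_of_isAlgebraic hIccσ hsalg) hGσ
  have hGS : IsSemialgebraicFunOn ℚ S (fun t => G (t 0)) :=
    hGσ.mono (fun t ht => ⟨le_of_lt ht.1, le_of_lt ht.2⟩) hSσ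
  have hGp'σ : IsSemialgebraicFunOn ℚ S
      (fun t => s * (G (t 0) * ((Qf (τ (t 0)) - Qf (t 0)) / yb (t 0)))) :=
    IsSemialgebraicFunOn.mul_holds (isSemialgebraicFunOn_const_of_isAlgebraic hSσ hsalg)
      (IsSemialgebraicFunOn.mul_holds hGS
        ((IsSemialgebraicFunOn.sub_holds hQfτS hQfS).div hybS hyb_ne))
  have hGppos : ∀ x ∈ Icc b c, 0 < s * G x := hspos
  have hGpc : ContinuousOn (fun x => s * G x) (Icc b c) := continuousOn_const.mul hGc
  have hGpd : ∀ x ∈ Ioo b c,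
      HasDerivAt (fun x => s * G x) (s * (G x * ((Qf (τ x) - Qf x) / yb x))) x :=
    fun x hx => (hGd x hx).const_mul s
  have hnegd : rdiff.neg.domain = {t | b < t 0 ∧ t 0 < c} := by
    rw [KZ.IntegralRep.domain_neg, hrdiff_d]
  have hnegi : EqOn rdiff.neg.integrand
      (fun t => s * (G (t 0) * ((Qf (τ (t 0)) - Qf (t 0)) / yb (t 0))) / (s * G (t 0)))
      rdiff.neg.domain := fun p hp => by
    rw [hnegd] at hp
    have hsG : s * G (p 0) ≠ 0 := (hspos (p 0) ⟨le_of_lt hp.1, le_of_lt hp.2⟩).ne'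
    rw [KZ.IntegralRep.integrand_neg, Pi.neg_apply, hrdiff_i]
    show -((Qf (τ (p 0)) - Qf (p 0)) / Real.sqrt (f (p 0))) =
      s * (G (p 0) * ((Qf (τ (p 0)) - Qf (p 0)) / yb (p 0))) / (s * G (p 0))
    rw [← mul_assoc, mul_div_cancel_left₀ _ hsG, hybx, div_neg]
  obtain ⟨κ, α, β, ε, cs, hcs, hlog, hrel⟩ := stub_dlogUnfold b c (fun x => s * G x)
    (fun x => s * (G x * ((Qf (τ x) - Qf x) / yb x))) rdiff.neg hbc hb hc hGppos hGpc hGpd hGpσ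
    hGp'σ hnegd hnegi
  /- ## Step 4: flip the signs and assemble -/
  refine ⟨κ, α, β, fun i => -ε i, cs, hcs, ?_, ?_⟩
  · have hb' : b ∈ Icc b c := left_mem_Icc.2 hbc.le
    have hc' : c ∈ Icc b c := right_mem_Icc.2 hbc.le
    simp only [Int.cast_neg, neg_mul, Finset.sum_neg_distrib, hlog]
    rw [Real.log_div (hspos c hc').ne' (hspos b hb').ne', habs b hb', habs c hc']
    ring
  · simp only [neg_smul, Finset.sum_neg_distrib, sub_neg_eq_add]
    have e : KZ.of θ₂ - KZ.of θ₁ + ∑ i, ε i • KZ.of (cs i) =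
        (KZ.of rmid - KZ.of θ₁ - KZ.of rdiff) - (KZ.of rmid - KZ.of θ₂)
          + (KZ.of rdiff + KZ.of rdiff.neg) - (KZ.of rdiff.neg - ∑ i, ε i • KZ.of (cs i)) := by
      abel
    rw [e]
    exact KZ.relations.sub_mem (KZ.relations.add_mem (KZ.relations.sub_mem hB hA) hC) hrel

end Summit.KontsevichZagierPeriods.KontsevichZagierPeriods.Cruxes.NeronTorsionSector.Translation

end
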